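import Summits.AtomisticToContinuum.BoseEinsteinCondensation.Theorems.BECCellInformationOneBodyEntropyBoundDirichletFloor
import Literature.MathematicalPhysics.QuantumManyBody.BoseGasThermodynamicLimitRuelle
import Literature.MathematicalPhysics.QuantumManyBody.PeriodicClusteringFromKyFanGap
import HarnessLib

/-!
# Near-minimisers are Cauchy in the energy norm (`stub_energyCauchy`)

Crux `stmt-AtomisticToContinuum-13034` (`RigidMomentumBound`, route `BECTangentRigidity`), line
`registered`, stub `stub_energyCauchy`: the ENERGY-CAUCHY PROPERTY OF NEAR-MINIMISERS of the
Dirichlet `N`-body Hamiltonian `H = -∑Δᵢ + ∑_{i<j} v(|xᵢ - xⱼ|)` in the box `Λ_L`. Write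
`Q(f) = ∫ (|∇f|² + ∑_{i<j} v |f|²)` for the quadratic form and `E₀ = groundStateEnergy v N L`
(assumed finite). If two admissible states `Φ, Ψ` both have energy `≤ E₀ + δ`, then
`Q(Φ - Ψ) ≤ E₀ ‖Φ - Ψ‖² + 4δ`.

Proof (parallelogram law, no spectral theory): pointwise, `|∇(Φ+Ψ)|² + |∇(Φ-Ψ)|² = 2|∇Φ|² + 2|∇Ψ|²`
(`kineticDensity_fun_add_add_sub`) and `|Φ+Ψ|² + |Φ-Ψ|² = 2|Φ|² + 2|Ψ|²`
(`ennreal_sq_nnnorm_add_add_sub`, both from `PeriodicClusteringFromKyFanGap.lean`), so in `[0, ∞]`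
(hard cores allowed)
`Q(Φ+Ψ) + Q(Φ-Ψ) = 2 Q(Φ) + 2 Q(Ψ) ≤ 4E₀ + 4δ` and `‖Φ+Ψ‖² + ‖Φ-Ψ‖² = 4`. The Dirichlet bosonic
floor (`DirichletFloor.groundStateEnergy_mul_lintegral_le`, no symmetry or normalisation needed)
applied to the `C¹` function `Φ + Ψ` vanishing off the box gives `E₀ ‖Φ+Ψ‖² ≤ Q(Φ+Ψ)`, whence
`Q(Φ-Ψ) + E₀ ‖Φ+Ψ‖² ≤ E₀ (‖Φ+Ψ‖² + ‖Φ-Ψ‖²) + 4δ` and the finite term `E₀ ‖Φ+Ψ‖²` cancels.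
-/

noncomputable section

namespace Summit.AtomisticToContinuum.BoseEinsteinCondensation.Theorems.RigidMomentumBound

open MeasureTheory Filter Set
open scoped ENNReal NNReal BigOperators
open Literature.MathematicalPhysics.QuantumManyBody.BoseGas

namespace EnergyCauchy

variable {N : ℕ}

/-- **Parallelogram law for the energy density** `|∇f|² + V|f|²` (any weight `V ∈ [0, ∞]`):
`e(φ+ψ) + e(φ-ψ) = 2(e(φ) + e(ψ))` pointwise. [folklore] -/
theorem energyDensity_add_add_energyDensity_sub (V : ℝ≥0∞) {φ ψ : Config N → ℂ}
    (hφ : Differentiable ℝ φ) (hψ : Differentiable ℝ ψ) (X : Config N) :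
    (kineticDensity (fun Y => φ Y + ψ Y) X + V * ((‖φ X + ψ X‖₊ : ℝ≥0∞)) ^ 2) +
        (kineticDensity (fun Y => φ Y - ψ Y) X + V * ((‖φ X - ψ X‖₊ : ℝ≥0∞)) ^ 2) =
      2 * ((kineticDensity φ X + V * ((‖φ X‖₊ : ℝ≥0∞)) ^ 2) +
        (kineticDensity ψ X + V * ((‖ψ X‖₊ : ℝ≥0∞)) ^ 2)) := by
  have hk := kineticDensity_fun_add_add_sub hφ hψ X
  have hn := ennreal_sq_nnnorm_add_add_sub (φ X) (ψ X)
  calc _ = (kineticDensity (fun Y => φ Y + ψ Y) X + kineticDensity (fun Y => φ Y - ψ Y) X) +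
        V * (((‖φ X + ψ X‖₊ : ℝ≥0∞)) ^ 2 + ((‖φ X - ψ X‖₊ : ℝ≥0∞)) ^ 2) := by ring
    _ = 2 * (kineticDensity φ X + kineticDensity ψ X) +
        V * (2 * (((‖φ X‖₊ : ℝ≥0∞)) ^ 2 + ((‖ψ X‖₊ : ℝ≥0∞)) ^ 2)) := by rw [hk, hn]
    _ = _ := by ring

/-- **Parallelogram law for the quadratic form** `Q(f) = ∫ (|∇f|² + ∑_{i<j} v |f|²)` of the
Dirichlet Hamiltonian (hard cores allowed): `Q(φ+ψ) + Q(φ-ψ) = 2(Q(φ) + Q(ψ))` for `C¹` `φ, ψ`.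
[folklore] -/
theorem form_add_add_form_sub {v : ℝ → ℝ≥0∞} (hv : Measurable v) {φ ψ : Config N → ℂ}
    (hφ : ContDiff ℝ 1 φ) (hψ : ContDiff ℝ 1 ψ) :
    (∫⁻ X, (kineticDensity (fun Y => φ Y + ψ Y) X +
        interaction v X * ((‖φ X + ψ X‖₊ : ℝ≥0∞)) ^ 2)) +
      (∫⁻ X, (kineticDensity (fun Y => φ Y - ψ Y) X +
        interaction v X * ((‖φ X - ψ X‖₊ : ℝ≥0∞)) ^ 2)) =
      2 * ((∫⁻ X, (kineticDensity φ X + interaction v X * ((‖φ X‖₊ : ℝ≥0∞)) ^ 2)) +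
        (∫⁻ X, (kineticDensity ψ X + interaction v X * ((‖ψ X‖₊ : ℝ≥0∞)) ^ 2))) := by
  rw [← lintegral_add_left (measurable_energyDensity hv (hφ.continuous.fun_add hψ.continuous)),
    ← lintegral_add_left (measurable_energyDensity hv hφ.continuous),
    ← lintegral_const_mul _ ((measurable_energyDensity hv hφ.continuous).fun_add
      (measurable_energyDensity hv hψ.continuous))]
  exact lintegral_congr fun X => energyDensity_add_add_energyDensity_sub (interaction v X)
    (hφ.differentiable one_ne_zero) (hψ.differentiable one_ne_zero) X

/-- Parallelogram law for the `L²` masses: `‖φ+ψ‖² + ‖φ-ψ‖² = 2(‖φ‖² + ‖ψ‖²)` (continuous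
`φ, ψ`). [folklore] -/
theorem mass_add_add_mass_sub {φ ψ : Config N → ℂ} (hφ : Continuous φ) (hψ : Continuous ψ) :
    (∫⁻ X, ((‖φ X + ψ X‖₊ : ℝ≥0∞)) ^ 2) + (∫⁻ X, ((‖φ X - ψ X‖₊ : ℝ≥0∞)) ^ 2) =
      2 * ((∫⁻ X, ((‖φ X‖₊ : ℝ≥0∞)) ^ 2) + (∫⁻ X, ((‖ψ X‖₊ : ℝ≥0∞)) ^ 2)) := by
  rw [← lintegral_add_left (measurable_ennnormSq (hφ.fun_add hψ)),
    ← lintegral_add_left (measurable_ennnormSq hφ),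
    ← lintegral_const_mul _ ((measurable_ennnormSq hφ).fun_add (measurable_ennnormSq hψ))]
  exact lintegral_congr fun X => ennreal_sq_nnnorm_add_add_sub (φ X) (ψ X)

/-- The `[0, ∞]` bookkeeping of the energy-Cauchy estimate: from `Q₊ + Q₋ ≤ 4E₀ + D`,
`E₀ M₊ ≤ Q₊`, `M₊ + M₋ = 4` and `E₀ < ∞` conclude `Q₋ ≤ E₀ M₋ + D` (the finite term `E₀ M₊`
cancels). [folklore] -/
theorem cauchy_bookkeeping {Qp Qm Mp Mm E₀ D : ℝ≥0∞} (hE : E₀ ≠ ⊤)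
    (hQ : Qp + Qm ≤ E₀ * 4 + D) (hfl : E₀ * Mp ≤ Qp) (hM : Mp + Mm = 4) :
    Qm ≤ E₀ * Mm + D := by
  have hMp : Mp ≠ ⊤ := by
    refine ne_top_of_le_ne_top (ENNReal.ofNat_ne_top (n := 4)) ?_
    calc Mp ≤ Mp + Mm := le_self_add
      _ = 4 := hM
  have hfin : E₀ * Mp ≠ ⊤ := ENNReal.mul_ne_top hE hMp
  refine (ENNReal.add_le_add_iff_right hfin).1 ?_
  calc Qm + E₀ * Mp ≤ Qm + Qp := add_le_add le_rfl hfl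
    _ = Qp + Qm := add_comm _ _
    _ ≤ E₀ * 4 + D := hQ
    _ = E₀ * (Mp + Mm) + D := by rw [hM]
    _ = E₀ * Mm + D + E₀ * Mp := by ring

end EnergyCauchy

open EnergyCauchy

/-- **`stub_energyCauchy` — near-minimisers are Cauchy in the energy norm.** For a measurable
pair potential `v` (hard cores allowed), `N` bosons in the Dirichlet box `Λ_L` with finite
ground-state energy `E₀ = groundStateEnergy v N L`, and two admissible states `Φ, Ψ` of energy
`≤ E₀ + δ` (`δ ≥ 0`), the quadratic form of the difference obeys
`Q(Φ - Ψ) ≤ E₀ ‖Φ - Ψ‖² + 4δ`, `Q(f) = ∫ (|∇f|² + ∑_{i<j} v |f|²)`.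
Proof: the parallelogram laws `Q(Φ+Ψ) + Q(Φ-Ψ) = 2Q(Φ) + 2Q(Ψ) ≤ 4E₀ + 4δ`
(`form_add_add_form_sub`) and `‖Φ+Ψ‖² + ‖Φ-Ψ‖² = 4` (`mass_add_add_mass_sub`), and the Dirichlet
bosonic floor `E₀ ‖Φ+Ψ‖² ≤ Q(Φ+Ψ)` for the (unnormalised, `C¹`, Dirichlet) function `Φ + Ψ`
(`DirichletFloor.groundStateEnergy_mul_lintegral_le`); cancel the finite `E₀ ‖Φ+Ψ‖²`
(`cauchy_bookkeeping`). [folklore] -/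
theorem stub_energyCauchy :
    ∀ (v : ℝ → ℝ≥0∞), Measurable v → ∀ {N : ℕ} {L : ℝ} (Φ Ψ : TrialState N L) (δ : ℝ), 0 ≤ δ →
      groundStateEnergy v N L ≠ ⊤ →
      energy v Φ ≤ groundStateEnergy v N L + ENNReal.ofReal δ →
      energy v Ψ ≤ groundStateEnergy v N L + ENNReal.ofReal δ →
      ∫⁻ X, (kineticDensity (fun X => Φ.ψ X - Ψ.ψ X) X +
          interaction v X * (‖Φ.ψ X - Ψ.ψ X‖₊ : ℝ≥0∞) ^ 2) ≤
        groundStateEnergy v N L * (∫⁻ X, (‖Φ.ψ X - Ψ.ψ X‖₊ : ℝ≥0∞) ^ 2) +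
          ENNReal.ofReal (4 * δ) := by
  intro v hv N L Φ Ψ δ _ hE₀ hΦ hΨ
  -- the Dirichlet bosonic floor for the unnormalised `C¹` Dirichlet function `Φ + Ψ`
  have hfl : groundStateEnergy v N L * ∫⁻ X, ((‖Φ.ψ X + Ψ.ψ X‖₊ : ℝ≥0∞)) ^ 2 ≤
      ∫⁻ X, (kineticDensity (fun Y => Φ.ψ Y + Ψ.ψ Y) X +
        interaction v X * ((‖Φ.ψ X + Ψ.ψ X‖₊ : ℝ≥0∞)) ^ 2) :=
    Cruxes.OneBodyEntropyBound.Birth.DirichletFloor.groundStateEnergy_mul_lintegral_le hv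
      (Φ.contDiff.add Ψ.contDiff) fun X hX => by
        simp only [Φ.eq_zero X hX, Ψ.eq_zero X hX, add_zero]
  -- the parallelogram laws
  have hQ := form_add_add_form_sub hv Φ.contDiff Ψ.contDiff
  have hM := mass_add_add_mass_sub (N := N) Φ.contDiff.continuous Ψ.contDiff.continuous
  rw [Φ.norm_eq, Ψ.norm_eq, show (2 : ℝ≥0∞) * (1 + 1) = 4 by norm_num] at hM
  -- `2 Q(Φ) + 2 Q(Ψ) ≤ 4 E₀ + 4 δ`
  have hQ' : (∫⁻ X, (kineticDensity (fun Y => Φ.ψ Y + Ψ.ψ Y) X +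
        interaction v X * ((‖Φ.ψ X + Ψ.ψ X‖₊ : ℝ≥0∞)) ^ 2)) +
      (∫⁻ X, (kineticDensity (fun Y => Φ.ψ Y - Ψ.ψ Y) X +
        interaction v X * ((‖Φ.ψ X - Ψ.ψ X‖₊ : ℝ≥0∞)) ^ 2)) ≤
      groundStateEnergy v N L * 4 + ENNReal.ofReal (4 * δ) := by
    rw [hQ]
    calc 2 * (energy v Φ + energy v Ψ)
        ≤ 2 * ((groundStateEnergy v N L + ENNReal.ofReal δ) +
            (groundStateEnergy v N L + ENNReal.ofReal δ)) := by gcongr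
      _ = groundStateEnergy v N L * 4 + ENNReal.ofReal (4 * δ) := by
        rw [ENNReal.ofReal_mul (by norm_num : (0 : ℝ) ≤ 4), ENNReal.ofReal_ofNat]
        ring
  exact cauchy_bookkeeping hE₀ hQ' hfl hM

end Summit.AtomisticToContinuum.BoseEinsteinCondensation.Theorems.RigidMomentumBound

end
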